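import Literature.Analysis.FluidPDE.ElgindiLinearizedOperator
import HarnessLib

/-!
# The radial weight `w² = (1+R)⁴/R⁴`: the two derivative bounds of [Elgindi2021] §7.3
(Proposition 7.7 Step 1)

Topic `Literature/Analysis/FluidPDE`. Proof file (everything proved, no definitions, no named
facts) on the proof path of the named fact
`Literature.Analysis.FluidPDE.Elgindi.ElgindiGhoulMasmoudi2021_stabilityCore`
(`ElgindiStabilityDecomposition.lean`). T. M. Elgindi, Ann. of Math. 194 (2021) =
arXiv:1904.04795, §7.3 proof of Proposition 7.7, Step 1 (p. 21):

> "Moreover, it can be checked directly that `|∂_R²(R²w²)| ≤ 6w²`, `|∂_R(Rw²)| ≤ 3w²`."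

With `w = (1+R)²/R²` (`radialWeight`): `∂_R(R²w²) = (1+R)³(2R−2)/R³`,
`∂_R²(R²w²) = (1+R)²(2R²−4R+6)/R⁴ ∈ [0, 6w²]` and `∂_R(Rw²) = (1+R)³(R−3)/R⁴`, `|∂_R(Rw²)| ≤ 3w²`
on `R > 0` (`deriv2_sq_mul_radialWeight_sq`, `abs_deriv_mul_radialWeight_sq_le`, …), together with
the smoothness of both weights on `(0,∞)`.
-/

noncomputable section

open Set Real Filter
open _root_.Topology

namespace Literature.Analysis.FluidPDE

namespace Elgindi

/-- `R²w² = (1+R)⁴/R²` for `R ≠ 0`. [folklore] -/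
theorem sq_mul_radialWeight_sq {R : ℝ} (hR : R ≠ 0) : R ^ 2 * radialWeight R ^ 2 = (1 + R) ^ 4 / R ^ 2 := by
  unfold radialWeight
  rw [div_pow, ← pow_mul, ← pow_mul, eq_div_iff (pow_ne_zero 2 hR)]
  field_simp
  norm_num
  ring

/-- `Rw² = (1+R)⁴/R³` for `R ≠ 0`. [folklore] -/
theorem mul_radialWeight_sq {R : ℝ} (hR : R ≠ 0) : R * radialWeight R ^ 2 = (1 + R) ^ 4 / R ^ 3 := by
  unfold radialWeight
  rw [div_pow, ← pow_mul, ← pow_mul, eq_div_iff (pow_ne_zero 3 hR)]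
  field_simp
  norm_num
  ring

/-- `w² = (1+R)⁴/R⁴`. [folklore] -/
theorem radialWeight_sq (R : ℝ) : radialWeight R ^ 2 = (1 + R) ^ 4 / R ^ 4 := by
  unfold radialWeight
  rw [div_pow, ← pow_mul, ← pow_mul]

/-- Both weights are smooth on `(0, ∞)`. [folklore] -/
theorem contDiffOn_sq_mul_radialWeight_sq {n : WithTop ℕ∞} :
    ContDiffOn ℝ n (fun R : ℝ => R ^ 2 * radialWeight R ^ 2) (Ioi 0) := by
  unfold radialWeight
  have h : ContDiffOn ℝ n (fun R : ℝ => (1 + R) ^ 2 / R ^ 2) (Ioi 0) :=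
    ContDiffOn.div (by fun_prop) (by fun_prop) fun R hR => pow_ne_zero 2 (ne_of_gt hR)
  exact (contDiffOn_id.pow 2).mul (h.pow 2)

/-- Both weights are smooth on `(0, ∞)`. [folklore] -/
theorem contDiffOn_mul_radialWeight_sq {n : WithTop ℕ∞} :
    ContDiffOn ℝ n (fun R : ℝ => R * radialWeight R ^ 2) (Ioi 0) := by
  unfold radialWeight
  have h : ContDiffOn ℝ n (fun R : ℝ => (1 + R) ^ 2 / R ^ 2) (Ioi 0) :=
    ContDiffOn.div (by fun_prop) (by fun_prop) fun R hR => pow_ne_zero 2 (ne_of_gt hR)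
  exact contDiffOn_id.mul (h.pow 2)

/-- `∂_R(R²w²) = (1+R)³(2R−2)/R³` on `R > 0`. [folklore] -/
theorem hasDerivAt_sq_mul_radialWeight_sq {R : ℝ} (hR : 0 < R) :
    HasDerivAt (fun R : ℝ => R ^ 2 * radialWeight R ^ 2) ((1 + R) ^ 3 * (2 * R - 2) / R ^ 3) R := by
  have hev : (fun R : ℝ => R ^ 2 * radialWeight R ^ 2) =ᶠ[𝓝 R] fun R => (1 + R) ^ 4 / R ^ 2 :=
    Filter.eventuallyEq_of_mem (Ioi_mem_nhds hR) fun R' hR' => sq_mul_radialWeight_sq (ne_of_gt hR')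
  refine HasDerivAt.congr_of_eventuallyEq ?_ hev
  have h1 : HasDerivAt (fun R : ℝ => (1 + R) ^ 4) (((4 : ℕ) : ℝ) * (1 + R) ^ (4 - 1) * 1) R := ((hasDerivAt_id' R).const_add 1).pow 4
  have h2 : HasDerivAt (fun R : ℝ => R ^ 2) (((2 : ℕ) : ℝ) * R ^ (2 - 1) * 1) R := (hasDerivAt_id' R).pow 2
  have h : HasDerivAt (fun R : ℝ => (1 + R) ^ 4 / R ^ 2)
      (((((4 : ℕ) : ℝ) * (1 + R) ^ (4 - 1) * 1) * R ^ 2 - (1 + R) ^ 4 * (((2 : ℕ) : ℝ) * R ^ (2 - 1) * 1)) / (R ^ 2) ^ 2) R :=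
    h1.div h2 (pow_ne_zero 2 hR.ne')
  refine h.congr_deriv ?_
  norm_num
  field_simp
  ring

/-- `∂_R²(R²w²) = (1+R)²(2R²−4R+6)/R⁴` on `R > 0`. [folklore] -/
theorem deriv2_sq_mul_radialWeight_sq {R : ℝ} (hR : 0 < R) :
    deriv (deriv fun R : ℝ => R ^ 2 * radialWeight R ^ 2) R = (1 + R) ^ 2 * (2 * R ^ 2 - 4 * R + 6) / R ^ 4 := by
  have hev : deriv (fun R : ℝ => R ^ 2 * radialWeight R ^ 2) =ᶠ[𝓝 R] fun R => (1 + R) ^ 3 * (2 * R - 2) / R ^ 3 :=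
    Filter.eventuallyEq_of_mem (Ioi_mem_nhds hR) fun R' hR' => (hasDerivAt_sq_mul_radialWeight_sq hR').deriv
  rw [hev.deriv_eq]
  have ha : HasDerivAt (fun R : ℝ => (1 + R) ^ 3) (((3 : ℕ) : ℝ) * (1 + R) ^ (3 - 1) * 1) R := ((hasDerivAt_id' R).const_add 1).pow 3
  have hb : HasDerivAt (fun R : ℝ => 2 * R - 2) (2 * 1) R := ((hasDerivAt_id' R).const_mul 2).sub_const 2
  have h1 : HasDerivAt (fun R : ℝ => (1 + R) ^ 3 * (2 * R - 2))
      (((3 : ℕ) : ℝ) * (1 + R) ^ (3 - 1) * 1 * (2 * R - 2) + (1 + R) ^ 3 * (2 * 1)) R := ha.mul hb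
  have h2 : HasDerivAt (fun R : ℝ => R ^ 3) (((3 : ℕ) : ℝ) * R ^ (3 - 1) * 1) R := (hasDerivAt_id' R).pow 3
  have h : HasDerivAt (fun R : ℝ => (1 + R) ^ 3 * (2 * R - 2) / R ^ 3)
      (((((3 : ℕ) : ℝ) * (1 + R) ^ (3 - 1) * 1 * (2 * R - 2) + (1 + R) ^ 3 * (2 * 1)) * R ^ 3 -
        (1 + R) ^ 3 * (2 * R - 2) * (((3 : ℕ) : ℝ) * R ^ (3 - 1) * 1)) / (R ^ 3) ^ 2) R := h1.div h2 (pow_ne_zero 3 hR.ne')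
  rw [h.deriv]
  norm_num
  field_simp
  ring

/-- **`0 ≤ ∂_R²(R²w²) ≤ 6w²` on `R > 0`.** [cite: Elgindi2021, §7.3 proof of Proposition 7.7 Step 1 (p. 21 of arXiv:1904.04795)] -/
theorem deriv2_sq_mul_radialWeight_sq_bounds {R : ℝ} (hR : 0 < R) :
    0 ≤ deriv (deriv fun R : ℝ => R ^ 2 * radialWeight R ^ 2) R ∧
      deriv (deriv fun R : ℝ => R ^ 2 * radialWeight R ^ 2) R ≤ 6 * radialWeight R ^ 2 := by
  rw [deriv2_sq_mul_radialWeight_sq hR, radialWeight_sq]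
  have hq : 0 ≤ 2 * R ^ 2 - 4 * R + 6 := by nlinarith [sq_nonneg (R - 1)]
  constructor
  · exact div_nonneg (mul_nonneg (sq_nonneg _) hq) (by positivity)
  · rw [mul_div_assoc']
    refine div_le_div_of_nonneg_right ?_ (by positivity)
    have h1 : 2 * R ^ 2 - 4 * R + 6 ≤ 6 * (1 + R) ^ 2 := by nlinarith
    calc (1 + R) ^ 2 * (2 * R ^ 2 - 4 * R + 6) ≤ (1 + R) ^ 2 * (6 * (1 + R) ^ 2) := mul_le_mul_of_nonneg_left h1 (sq_nonneg _)
      _ = 6 * (1 + R) ^ 4 := by ring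

/-- `∂_R(Rw²) = (1+R)³(R−3)/R⁴` on `R > 0`. [folklore] -/
theorem hasDerivAt_mul_radialWeight_sq {R : ℝ} (hR : 0 < R) :
    HasDerivAt (fun R : ℝ => R * radialWeight R ^ 2) ((1 + R) ^ 3 * (R - 3) / R ^ 4) R := by
  have hev : (fun R : ℝ => R * radialWeight R ^ 2) =ᶠ[𝓝 R] fun R => (1 + R) ^ 4 / R ^ 3 :=
    Filter.eventuallyEq_of_mem (Ioi_mem_nhds hR) fun R' hR' => mul_radialWeight_sq (ne_of_gt hR')
  refine HasDerivAt.congr_of_eventuallyEq ?_ hev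
  have h1 : HasDerivAt (fun R : ℝ => (1 + R) ^ 4) (((4 : ℕ) : ℝ) * (1 + R) ^ (4 - 1) * 1) R := ((hasDerivAt_id' R).const_add 1).pow 4
  have h2 : HasDerivAt (fun R : ℝ => R ^ 3) (((3 : ℕ) : ℝ) * R ^ (3 - 1) * 1) R := (hasDerivAt_id' R).pow 3
  have h : HasDerivAt (fun R : ℝ => (1 + R) ^ 4 / R ^ 3)
      (((((4 : ℕ) : ℝ) * (1 + R) ^ (4 - 1) * 1) * R ^ 3 - (1 + R) ^ 4 * (((3 : ℕ) : ℝ) * R ^ (3 - 1) * 1)) / (R ^ 3) ^ 2) R :=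
    h1.div h2 (pow_ne_zero 3 hR.ne')
  refine h.congr_deriv ?_
  norm_num
  field_simp
  ring

/-- **`|∂_R(Rw²)| ≤ 3w²` on `R > 0`.** [cite: Elgindi2021, §7.3 proof of Proposition 7.7 Step 1 (p. 21 of arXiv:1904.04795)] -/
theorem abs_deriv_mul_radialWeight_sq_le {R : ℝ} (hR : 0 < R) :
    |deriv (fun R : ℝ => R * radialWeight R ^ 2) R| ≤ 3 * radialWeight R ^ 2 := by
  rw [(hasDerivAt_mul_radialWeight_sq hR).deriv, radialWeight_sq, abs_div, abs_of_pos (pow_pos hR 4), abs_mul,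
    abs_of_pos (pow_pos (by linarith : (0 : ℝ) < 1 + R) 3), mul_div_assoc']
  refine div_le_div_of_nonneg_right ?_ (by positivity)
  have h3 : |R - 3| ≤ 3 * (1 + R) := by
    rw [abs_le]; constructor <;> linarith
  calc (1 + R) ^ 3 * |R - 3| ≤ (1 + R) ^ 3 * (3 * (1 + R)) := mul_le_mul_of_nonneg_left h3 (by positivity)
    _ = 3 * (1 + R) ^ 4 := by ring

end Elgindi

end Literature.Analysis.FluidPDE
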